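import Summits.Ventures.LatticeQCDFlow.Scaling.SectorFreshness
import Summits.Ventures.LatticeQCDFlow.Scaling.BooleanStarColdStartLaw
import Literature.Probability.MarkovChains.ProjectedChain

/-!
HONEST FRAMING: exact (Metropolis-corrected) sampling algorithms for lattice gauge theory; figures
of merit are autocorrelation/cost numbers at stated couplings and volumes; no continuum-physics
claim.

# SectorExactLabelChain — UNDER SECTOR-EXACT TRANSPORT THE SECTOR LABELS OF THE PERSISTENT HUB FORM A MARKOV CHAIN, AND IT IS
# THE LABEL STAR (THE BOOLEAN STAR OF CHAPTER P FOR TWO SECTORS): STRONG LUMPABILITY `Σ_{z' : ℓ(z') = s'} P(z, z') = P_L(ℓ(z), s')` WITH LABEL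
# LAWS `μ^L_k(b) = μ_k(ℓ = b)`, IDENTITY MAPS, EXACT HOT REDRAW AND IDLE COLD LABELS; HENCE `Σ_{ℓ(z) = s} (δ_x Pⁿ)(z) = (δ_{ℓ(x)} P_Lⁿ)(s)` (lean-2 GEN-30, ours)

Venture-side (OURS).  Cell `lqcd-flow` (pub-lqcd), unit `pub-lqcd-lean-2-g30`, 2026-08-28.  Chapter Q (item 1 for sector-exact maps on a
general `S`), file 4.  Setting of `Scaling/SectorExactAugmentation`: a partition `ℓ : S → L`, maps `φ_r` preserving the labels with `μ_{κ_r+1}(φ_r u) = c_r(ℓ u)μ_0(u)`,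
exact hot redraws, sector-confined cold kernels.  The coordinatewise label map `z ↦ (k ↦ ℓ(z_k))` sends the scheme onto the LABEL STAR on `L` — the scheme of
`Scaling/BooleanStarCoupling` when `L = Bool` — with laws `μ^L_k(b) = Σ_{ℓu = b} μ_k(u)` (carried as a hypothesis-equation), identity entry maps, the exact hot
redraw `μ^L_0` and identity cold kernels (a sector-confined move never changes a label).  Levin–Peres–Wilmer's Lemma 2.5 (projected chains, in
the tree: `Literature/Probability/MarkovChains/ProjectedChain`) turns lumpability into the identity of laws.

## What is proved

* §1 `label_update`, `label_entrySwap` (the label map intertwines updates and entry swaps), `sum_filter_label_ite`,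
  **`sectorExact_labelMass`** (`μ_l([·∈A] = b) = c_r(b)·μ_0([·∈A] = b)`: summing sector-exactness over a sector),
  **`boolLabel_accept_eq`** (the label star's acceptance at `ℓ(z)` is `min{1, c_r(ℓ z_0)/c_r(ℓ z_l)} = α_r(z)`).
* §2 **`sectorExact_label_lump`** — STRONG LUMPABILITY: `P_B(ℓ z, s') = Σ_{z' : ℓ z' = s'} P(z, z')` for every `z`, `s'`;
  **`sectorExact_label_lawAt`** — `Σ_{z : ℓ z = s} (δ_x Pⁿ)(z) = (δ_{ℓ x} P_Bⁿ)(s)`; `sectorExact_label_tensorFun` (`Σ_{ℓ z = s} π̃(z) = π̃_B(s)`).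

Reading (no numerics implied): the topological-sector content of every replica evolves autonomously, as the two-point model whose cold-start
law chapter P computed without the volume.  NOT CLAIMED here: the law of the full configuration (file 5).  Literature grade (cell rule): OWN
on [LevinPeres2017, Lemma 2.5] (tree file); nothing new cited as a fact; no new bib keys.
-/

noncomputable section

open Finset Function
open Literature.Probability.MarkovChains

namespace Summit.Ventures.LatticeQCDFlow.Scaling

variable {S : Type*} [Fintype S] [DecidableEq S] {K m : ℕ} {μ : Fin (K + 1) → S → ℝ} {M : Fin (K + 1) → S → S → ℝ}
  {w : Fin (K + 1) → ℝ} {t : ℝ}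

section LabelChain
variable (κ : Fin m → Fin K) (φ : Fin m → Equiv.Perm S) {L : Type*} [Fintype L] [DecidableEq L] (ℓ : S → L)

/-! ## §1 The label map -/

/-- The single-coordinate kernel as a sum of point masses (general state space): `P̃_k(x,z) = Σ_v M_k(x_k,v)·𝟙{z = x[k ↦ v]}`. [ours] -/
theorem coordKernel_eq_sum_ite' (k : Fin (K + 1)) (x z : Fin (K + 1) → S) :
    coordKernel M k x z = ∑ v : S, M k (x k) v * (if z = update x k v then (1 : ℝ) else 0) := by
  unfold coordKernel
  by_cases h : z = update x k (z k)
  · rw [if_pos h, Finset.sum_eq_single (z k)]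
    · rw [if_pos h, mul_one]
    · intro v _ hv
      rw [if_neg, mul_zero]
      intro h'
      apply hv
      have := congrFun h' k
      rw [update_self] at this
      exact this.symm
    · intro h'; exact absurd (mem_univ _) h'
  · rw [if_neg h]
    symm
    refine sum_eq_zero fun v _ => ?_
    rw [if_neg, mul_zero]
    intro h'
    apply h
    have hv : z k = v := by have := congrFun h' k; rw [update_self] at this; exact this
    rw [hv]; exact h'

omit [Fintype S] [DecidableEq S] [Fintype L] [DecidableEq L] in
/-- `ℓ(z[k ↦ v]) = ℓ(z)[k ↦ ℓ v]` (coordinatewise labels). [ours] -/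
theorem label_update (z : Fin (K + 1) → S) (k : Fin (K + 1)) (v : S) :
    (fun k' => ℓ (update z k v k')) = update (fun k' => ℓ (z k')) k (ℓ v) := by
  funext k'
  by_cases h : k' = k
  · subst h; rw [update_self, update_self]
  · rw [update_of_ne h, update_of_ne h]

omit [Fintype S] [DecidableEq S] [Fintype L] [DecidableEq L] in
/-- `ℓ(y_r z) = y^B_r(ℓ z)`: the entry swap through a sector-preserving map is the identity-map swap of the labels. [ours] -/
theorem label_entrySwap (hφℓ : ∀ r u, ℓ (φ r u) = ℓ u) (r : Fin m) (z : Fin (K + 1) → S) :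
    (fun k => ℓ (edgeFlowSwap (φ r) 0 (κ r).succ z k))
      = edgeFlowSwap (Equiv.refl L) 0 (κ r).succ (fun k => ℓ (z k)) := by
  obtain ⟨hy0, hyl, hyoff⟩ := entrySwap_apply κ φ r z
  obtain ⟨hb0, hbl, hboff⟩ := entrySwap_apply κ (fun _ : Fin m => Equiv.refl L) r (fun k => ℓ (z k))
  funext k
  by_cases hk0 : k = 0
  · subst hk0
    rw [hy0, hb0, Equiv.refl_symm, Equiv.refl_apply]
    exact symm_label φ ℓ hφℓ r _
  · by_cases hkl : k = (κ r).succ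
    · subst hkl
      rw [hyl, hbl, Equiv.refl_apply]
      exact hφℓ r _
    · rw [hyoff k hk0 hkl, hboff k hk0 hkl]

omit [Fintype S] in
/-- `Σ_{z' ∈ filter p} 𝟙{z' = y} = 𝟙{p y}`. [ours] -/
theorem sum_filter_label_ite [Fintype S] (p : (Fin (K + 1) → S) → Prop) [DecidablePred p] (y : Fin (K + 1) → S) :
    ∑ z' ∈ univ.filter p, (if z' = y then (1 : ℝ) else 0) = if p y then (1 : ℝ) else 0 := by
  rw [Finset.sum_filter, Finset.sum_eq_single y]
  · by_cases hp : p y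
    · rw [if_pos hp, if_pos hp, if_pos rfl]
    · rw [if_neg hp, if_neg hp]
  · intro z' _ hz'
    rw [if_neg hz']
    split_ifs <;> rfl
  · intro h; exact absurd (mem_univ _) h

omit [DecidableEq S] [Fintype L] in
/-- **SUMMING SECTOR-EXACTNESS OVER A SECTOR:** `Σ_{ℓu=b} μ_l(u) = c_r(b)·Σ_{ℓu=b} μ_0(u)` (`φ_r` preserves the labels). [ours] -/
theorem sectorExact_labelMass (hφℓ : ∀ r u, ℓ (φ r u) = ℓ u) {cL : Fin m → L → ℝ}
    (hexact : ∀ r u, μ (κ r).succ (φ r u) = cL r (ℓ u) * μ 0 u) (r : Fin m) (b : L) :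
    ∑ u ∈ univ.filter (fun u => ℓ u = b), μ (κ r).succ u
      = cL r b * ∑ u ∈ univ.filter (fun u => ℓ u = b), μ 0 u := by
  rw [Finset.sum_filter, Finset.sum_filter, Finset.mul_sum]
  -- reindex the left sum by `φ_r`
  rw [← Equiv.sum_comp (φ r) (fun u => if ℓ u = b then μ (κ r).succ u else 0)]
  refine sum_congr rfl fun u _ => ?_
  rw [hφℓ r u]
  split_ifs with h1
  · rw [hexact r u, h1]
  · rw [mul_zero]

omit [DecidableEq S] in
/-- The label star's acceptance at the labels equals the scheme's: `min{1, π̃_L(y^L s)/π̃_L(s)} = min{1, c_r(s_0)/c_r(s_l)}`,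
with `μ^L_k(b) = Σ_{ℓu=b} μ_k(u) > 0`. [ours] -/
theorem boolLabel_accept_eq (hφℓ : ∀ r u, ℓ (φ r u) = ℓ u) {cL : Fin m → L → ℝ} (hcL : ∀ r b, 0 < cL r b)
    (hexact : ∀ r u, μ (κ r).succ (φ r u) = cL r (ℓ u) * μ 0 u)
    {μB : Fin (K + 1) → L → ℝ} (hμB : ∀ k b, μB k b = ∑ u ∈ univ.filter (fun u => ℓ u = b), μ k u)
    (hμB0 : ∀ k b, 0 < μB k b) (r : Fin m) (s : Fin (K + 1) → L) :
    min 1 (tensorFun μB (edgeFlowSwap (Equiv.refl L) 0 (κ r).succ s) / tensorFun μB s)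
      = min 1 (cL r (s 0) / cL r (s (κ r).succ)) := by
  have h := accept_mul_pair κ (fun _ : Fin m => Equiv.refl L) hμB0 (α := fun r s =>
    min 1 (tensorFun μB (edgeFlowSwap (Equiv.refl L) 0 (κ r).succ s) / tensorFun μB s)) (fun _ _ => rfl) r s
  simp only [Equiv.refl_symm, Equiv.refl_apply] at h
  have hpos : 0 < μB 0 (s 0) * μB (κ r).succ (s (κ r).succ) := mul_pos (hμB0 _ _) (hμB0 _ _)
  have hl : ∀ b, μB (κ r).succ b = cL r b * μB 0 b := by
    intro b; rw [hμB, hμB, sectorExact_labelMass κ φ ℓ hφℓ hexact r b]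
  have hc0pos : 0 < cL r (s 0) := hcL r _
  have hclpos : 0 < cL r (s (κ r).succ) := hcL r _
  have hswap : μB 0 (s (κ r).succ) * μB (κ r).succ (s 0) = (μB 0 (s 0) * μB (κ r).succ (s (κ r).succ))
      * (cL r (s 0) / cL r (s (κ r).succ)) := by
    rw [hl (s 0), hl (s (κ r).succ)]
    field_simp
  have key : min (μB 0 (s 0) * μB (κ r).succ (s (κ r).succ)) ((μB 0 (s 0) * μB (κ r).succ (s (κ r).succ))
        * (cL r (s 0) / cL r (s (κ r).succ)))
      = (μB 0 (s 0) * μB (κ r).succ (s (κ r).succ)) * min 1 (cL r (s 0) / cL r (s (κ r).succ)) := by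
    rw [mul_min_of_nonneg _ _ hpos.le, mul_one]
  rw [hswap, key] at h
  exact mul_right_cancel₀ hpos.ne' (h.trans (mul_comm _ _))

/-! ## §2 Strong lumpability and the label law -/

/-- **STRONG LUMPABILITY OF THE LABELS:** for every configuration `z` and label configuration `s'`,
`P_B(ℓ z, s') = Σ_{z' : ℓ z' = s'} P(z, z')` — sector-exact maps, exact hot redraw, sector-confined cold kernels (`m ≥ 1`, `μ > 0`, both
sectors charged by every law). [ours] -/
theorem sectorExact_label_lump (hm : 1 ≤ m) (hμ : ∀ k x, 0 < μ k x) (hφℓ : ∀ r u, ℓ (φ r u) = ℓ u) {cL : Fin m → L → ℝ}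
    (hcL : ∀ r b, 0 < cL r b) (hexact : ∀ r u, μ (κ r).succ (φ r u) = cL r (ℓ u) * μ 0 u)
    (hM : ∀ k, IsRowStochastic (M k)) (hM0 : ∀ u v, M 0 u v = μ 0 v)
    (hconf : ∀ k : Fin (K + 1), k ≠ 0 → ∀ u v, ℓ u ≠ ℓ v → M k u v = 0)
    {μB : Fin (K + 1) → L → ℝ} (hμB : ∀ k b, μB k b = ∑ u ∈ univ.filter (fun u => ℓ u = b), μ k u)
    (hμB0 : ∀ k b, 0 < μB k b) (z : Fin (K + 1) → S) (s' : Fin (K + 1) → L) :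
    (t * ptGraphSwap μB (fun r : Fin m => (((0 : Fin (K + 1)), (κ r).succ) : Fin (K + 1) × Fin (K + 1)))
          (fun _ : Fin m => Equiv.refl L) (fun k => ℓ (z k)) s'
        + (1 - t) * prodKernel w (fun (k : Fin (K + 1)) (u v : L) => if k = 0 then μB 0 v else (if u = v then (1 : ℝ) else 0))
          (fun k => ℓ (z k)) s')
      = ∑ z' ∈ univ.filter (fun z' : Fin (K + 1) → S => (fun k => ℓ (z' k)) = s'),
          (t * ptGraphSwap μ (fun r : Fin m => (((0 : Fin (K + 1)), (κ r).succ) : Fin (K + 1) × Fin (K + 1))) φ z z'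
            + (1 - t) * prodKernel w M z z') := by
  have he := hubList_fst_ne_snd (K := K) κ
  -- accept/reject forms on both sides
  have hαS := entrySwap_eq_accept_reject κ φ hμ (α := fun r z =>
    min 1 (tensorFun μ (edgeFlowSwap (φ r) 0 (κ r).succ z) / tensorFun μ z)) (fun _ _ => rfl)
  have hαB := entrySwap_eq_accept_reject κ (fun _ : Fin m => Equiv.refl L) hμB0 (α := fun r s =>
    min 1 (tensorFun μB (edgeFlowSwap (Equiv.refl L) 0 (κ r).succ s) / tensorFun μB s)) (fun _ _ => rfl)
  -- the two acceptances agree at `ℓ z`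
  have hacc : ∀ r : Fin m, min 1 (tensorFun μB (edgeFlowSwap (Equiv.refl L) 0 (κ r).succ (fun k => ℓ (z k))) / tensorFun μB (fun k => ℓ (z k)))
      = min 1 (tensorFun μ (edgeFlowSwap (φ r) 0 (κ r).succ z) / tensorFun μ z) := by
    intro r
    rw [boolLabel_accept_eq κ φ ℓ hφℓ hcL hexact hμB hμB0 r (fun k => ℓ (z k)),
      sectorExact_accept_eq κ φ ℓ hμ hφℓ hcL hexact (α := fun r z =>
        min 1 (tensorFun μ (edgeFlowSwap (φ r) 0 (κ r).succ z) / tensorFun μ z)) (fun _ _ => rfl) r z]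
  rw [Finset.sum_add_distrib, ← Finset.mul_sum, ← Finset.mul_sum]
  congr 1
  · -- the entry part
    congr 1
    rw [ptGraphSwap_eq_avg_entryKernel hm he hμB0, Finset.sum_congr rfl fun z' _ => ptGraphSwap_eq_avg_entryKernel hm he hμ z z',
      Finset.sum_comm]
    refine sum_congr rfl fun r _ => ?_
    rw [← Finset.mul_sum]
    congr 1
    rw [hαB r, Finset.sum_congr rfl fun z' _ => hαS r z z', Finset.sum_add_distrib, ← Finset.mul_sum, ← Finset.mul_sum,
      sum_filter_label_ite, sum_filter_label_ite, hacc r]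
    have h1 : ((fun k => ℓ (edgeFlowSwap (φ r) 0 (κ r).succ z k)) = s') ↔ (s' = edgeFlowSwap (Equiv.refl L) 0 (κ r).succ (fun k => ℓ (z k))) := by
      rw [show (fun k => ℓ (edgeFlowSwap (φ r) 0 (κ r).succ z k)) = edgeFlowSwap (Equiv.refl L) 0 (κ r).succ (fun k => ℓ (z k)) from
        label_entrySwap κ φ ℓ hφℓ r z, eq_comm]
    have h2 : ((fun k => ℓ (z k)) = s') ↔ (s' = (fun k => ℓ (z k))) := eq_comm
    rw [if_congr h1 rfl rfl, if_congr h2 rfl rfl]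
  · -- the update part
    congr 1
    rw [prodKernel_apply, Finset.sum_congr rfl fun z' _ => prodKernel_apply M w z z', Finset.sum_comm]
    refine sum_congr rfl fun k _ => ?_
    rw [← Finset.mul_sum]
    congr 1
    -- `Σ_{ℓ z' = s'} P̃_k(z, z') = Σ_v M_k(z_k, v) 𝟙{ℓ(z[k ↦ v]) = s'}`
    rw [Finset.sum_congr rfl fun z' _ => coordKernel_eq_sum_ite' (M := M) k z z', Finset.sum_comm]
    simp_rw [← Finset.mul_sum, sum_filter_label_ite]
    simp_rw [label_update ℓ z k]
    rw [show coordKernel (fun (k : Fin (K + 1)) (u v : L) => if k = 0 then μB 0 v else (if u = v then (1 : ℝ) else 0)) k (fun k => ℓ (z k)) s'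
        = (if s' = update (fun k => ℓ (z k)) k (s' k) then (if k = 0 then μB 0 (s' k) else (if (fun k => ℓ (z k)) k = s' k then (1 : ℝ) else 0)) else 0)
        from rfl]
    by_cases hk : k = 0
    · subst hk
      rw [if_pos rfl]
      simp_rw [hM0]
      by_cases hs : s' = update (fun k => ℓ (z k)) 0 (s' 0)
      · rw [if_pos hs, hμB, Finset.sum_filter]
        refine sum_congr rfl fun v _ => ?_
        by_cases hv : ℓ v = s' 0
        · rw [if_pos hv, hv, if_pos hs.symm, mul_one]
        · rw [if_neg hv, if_neg (fun h => hv (by rw [← h, update_self])), mul_zero]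
      · rw [if_neg hs]
        symm
        refine sum_eq_zero fun v _ => ?_
        rw [if_neg, mul_zero]
        intro h
        apply hs
        have h0 : s' 0 = ℓ v := by rw [← h, update_self]
        rw [h0]; exact h.symm
    · rw [if_neg hk]
      have hconst : ∀ v : S, M k (z k) v * (if update (fun k => ℓ (z k)) k (ℓ v) = s' then (1 : ℝ) else 0)
          = M k (z k) v * (if (fun k => ℓ (z k)) = s' then (1 : ℝ) else 0) := by
        intro v
        by_cases hlab : ℓ (z k) = ℓ v
        · have hd : ℓ v = (fun k => ℓ (z k)) k := hlab.symm
          rw [hd, update_eq_self]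
        · rw [hconf k hk (z k) v hlab, zero_mul, zero_mul]
      simp_rw [hconst]
      rw [← Finset.sum_mul, (hM k).2, one_mul]
      by_cases hs : (fun k => ℓ (z k)) = s'
      · subst hs; rw [update_eq_self, if_pos rfl, if_pos rfl, if_pos rfl]
      · rw [if_neg hs]
        by_cases hs2 : s' = update (fun k => ℓ (z k)) k (s' k)
        · rw [if_pos hs2, if_neg]
          intro h
          apply hs
          rw [hs2, ← h, update_eq_self]
        · rw [if_neg hs2]

/-- **THE LABEL LAW IS THE BOOLEAN STAR'S LAW:** `Σ_{z : ℓ z = s} (δ_x Pⁿ)(z) = (δ_{ℓ x} P_Bⁿ)(s)` for all `n`, `s`. [ours] -/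
theorem sectorExact_label_lawAt (hm : 1 ≤ m) (hμ : ∀ k x, 0 < μ k x) (hφℓ : ∀ r u, ℓ (φ r u) = ℓ u) {cL : Fin m → L → ℝ}
    (hcL : ∀ r b, 0 < cL r b) (hexact : ∀ r u, μ (κ r).succ (φ r u) = cL r (ℓ u) * μ 0 u)
    (hM : ∀ k, IsRowStochastic (M k)) (hM0 : ∀ u v, M 0 u v = μ 0 v)
    (hconf : ∀ k : Fin (K + 1), k ≠ 0 → ∀ u v, ℓ u ≠ ℓ v → M k u v = 0)
    {μB : Fin (K + 1) → L → ℝ} (hμB : ∀ k b, μB k b = ∑ u ∈ univ.filter (fun u => ℓ u = b), μ k u)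
    (hμB0 : ∀ k b, 0 < μB k b) (x : Fin (K + 1) → S) (n : ℕ) (s : Fin (K + 1) → L) :
    ∑ z ∈ univ.filter (fun z : Fin (K + 1) → S => (fun k => ℓ (z k)) = s),
        lawAt (fun y z : Fin (K + 1) → S =>
          t * ptGraphSwap μ (fun r : Fin m => (((0 : Fin (K + 1)), (κ r).succ) : Fin (K + 1) × Fin (K + 1))) φ y z
            + (1 - t) * prodKernel w M y z) (Pi.single x 1) n z
      = lawAt (fun y s : Fin (K + 1) → L =>
          t * ptGraphSwap μB (fun r : Fin m => (((0 : Fin (K + 1)), (κ r).succ) : Fin (K + 1) × Fin (K + 1)))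
              (fun _ : Fin m => Equiv.refl L) y s
            + (1 - t) * prodKernel w (fun (k : Fin (K + 1)) (u v : L) => if k = 0 then μB 0 v else (if u = v then (1 : ℝ) else 0)) y s)
          (Pi.single (fun k => ℓ (x k)) 1) n s := by
  rw [LevinPeres2017_lemma_2_5_lawAt (proj := fun (z : Fin (K + 1) → S) (k : Fin (K + 1)) => ℓ (z k))
    (Ps := fun y s : Fin (K + 1) → L =>
          t * ptGraphSwap μB (fun r : Fin m => (((0 : Fin (K + 1)), (κ r).succ) : Fin (K + 1) × Fin (K + 1)))
              (fun _ : Fin m => Equiv.refl L) y s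
            + (1 - t) * prodKernel w (fun (k : Fin (K + 1)) (u v : L) => if k = 0 then μB 0 v else (if u = v then (1 : ℝ) else 0)) y s)
    (fun z s' => sectorExact_label_lump κ φ ℓ hm hμ hφℓ hcL hexact hM hM0 hconf hμB hμB0 z s')]
  congr 1
  funext s'
  rw [Finset.sum_filter]
  by_cases hs : (fun k => ℓ (x k)) = s'
  · subst hs
    rw [Pi.single_eq_same, Finset.sum_eq_single x]
    · rw [if_pos rfl, Pi.single_eq_same]
    · intro z _ hz; rw [Pi.single_eq_of_ne hz]; split_ifs <;> rfl
    · intro h; exact absurd (mem_univ _) h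
  · rw [Pi.single_eq_of_ne (Ne.symm hs)]
    refine sum_eq_zero fun z _ => ?_
    by_cases hz : z = x
    · subst hz; rw [if_neg hs]
    · rw [Pi.single_eq_of_ne hz]; split_ifs <;> rfl

omit [DecidableEq S] [Fintype L] in
/-- The product law lumps onto the product of the label laws: `Σ_{ℓ z = s} π̃(z) = π̃_B(s)`. [ours] -/
theorem sectorExact_label_tensorFun {μB : Fin (K + 1) → L → ℝ}
    (hμB : ∀ k b, μB k b = ∑ u ∈ univ.filter (fun u => ℓ u = b), μ k u) (s : Fin (K + 1) → L) :
    ∑ z ∈ univ.filter (fun z : Fin (K + 1) → S => (fun k => ℓ (z k)) = s), tensorFun μ z = tensorFun μB s := by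
  unfold tensorFun
  simp_rw [hμB, Finset.sum_filter]
  rw [Finset.prod_univ_sum, Fintype.piFinset_univ]
  -- `Π_k Σ_u 𝟙{ℓ u = s_k} μ_k(u) = Σ_z Π_k 𝟙{ℓ z_k = s_k} μ_k(z_k)`
  refine (sum_congr rfl fun z _ => ?_).symm
  rw [Finset.prod_ite_zero]
  have hiff : (∀ i ∈ (univ : Finset (Fin (K + 1))), ℓ (z i) = s i) ↔ ((fun k => ℓ (z k)) = s) :=
    ⟨fun h => funext fun k => h k (mem_univ k), fun h i _ => congrFun h i⟩
  by_cases h : (fun k => ℓ (z k)) = s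
  · rw [if_pos h, if_pos (hiff.mpr h)]
  · rw [if_neg h, if_neg (fun h' => h (hiff.mp h'))]

end LabelChain

end Summit.Ventures.LatticeQCDFlow.Scaling

end
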